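import Summits.BirchSwinnertonDyer.BirchSwinnertonDyer.Theorems.BiquadraticEisensteinDescentDeuringCoreRowTwo
import Summits.BirchSwinnertonDyer.BirchSwinnertonDyer.Theorems.BiquadraticEisensteinDescentDeuringOfCore
import Literature.NumberTheory.EllipticCurves.GrossCurveDeuringCore
import Literature.NumberTheory.QuadraticFields.SqrtNegTwoGrossencharakter
import Literature.NumberTheory.QuadraticFields.OmegaPrimeGrossencharakterDatum
import Literature.NumberTheory.EllipticCurves.SqrtTwoTwistHeckeCoefficients
import Literature.NumberTheory.EllipticCurves.SqrtTwoTwistBrewerTheorem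
import Literature.NumberTheory.EllipticCurves.ComplexMultiplicationTwistIsogenyProofs
import HarnessLib

set_option linter.dupNamespace false -- `Summit.BirchSwinnertonDyer.BirchSwinnertonDyer.Theorems.…` (summit = sub)
set_option autoImplicit false

/-!
# BED route, «Deuring-ψ lane»: the row `j = 8000` (`K = ℚ(√−2)`) of `Deuring_exists_heckeCharacter_of_maximalCM`, modulo CORE of `B₁ = [0,4,0,2,0]`

Route `BiquadraticEisensteinDescent` of `Summits/BirchSwinnertonDyer` (crux `EisensteinHeartFlatCMInertBadKPrime`, stmt-BirchSwinnertonDyer-21341;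
cell `bsd-wall`, seat w4 g17). THEOREMS ONLY.

* §1 ★ `core_of_datum` — the abstract «ideal Größencharakter datum ⇒ CORE» step for a curve `W/ℚ` with ONE bad prime `ℓ`, the prime
  ramified in the imaginary quadratic `K`: a Größencharakter `ψ₀ mod 𝔣` of type `(1,0)` supported at `ℓ` (`𝔣 ∣ 𝔭 ↔ ℓ ∈ 𝔭`), an
  integer ramification witness `n` prime to `ℓ` with `ψ̃₀((n)) ≠ n`, Deuring's split/inert Frobenius values against `a_p(W)` at `p ≠ ℓ`,
  `a_ℓ(W) = 0` and `p ∣ N_W ↔ p = ℓ` give `L(s, heckeOfGross ψ₀) = L(W, s)` on `re s > 3/2` (generalises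
  `GrossCurve.exists_heckeCharacter_pinned_of_lFunction_eq_heckeSum`, which is the case `ℓ = q ≥ 7`).
* §2 ★ `core_cm8_quadraticTwist_neg_one` — CORE for `B₋₁ = [0,−4,0,2,0] = cm8^{(−1)}` and every CM field `K` of `j = 8000`, from the
  `ℚ(√−2)` datum `SqrtNegTwo.exists_isGrossencharakter_datum` (seat w1 g14; Rajwade's character `(π) ↦ primary π mod 4√−2`) and
  `a_m(B₋₁) = S(m)` (`SqrtTwoTwist.lFunction_eq_jacobiSym_mul_primarySum`, Brewer's theorem proved in the tree).
* §3 `core_of_j_eq_8000_of_core_cm8`, `deuring_of_j_eq_8000_of_core_cm8` — the whole row from CORE(`cm8`) (the second base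
  `B₁ = [0,4,0,2,0]`, `a_p = (−1/p)·S(p)`, whose datum is the `χ₋₄ ∘ N`-twist of Rajwade's character — pending) via
  `core_of_j_eq_of_core_pair_two`.

BSD is not proved by any of this. References: [SilvermanATAEC1994] II Thm. 9.2, Thm. 10.5, Ex. 2.30–2.32; [Rajwade1968] Thm. 1;
[SilvermanAEC2009] X.5 Cor. 5.4.1, VII.5 Prop. 5.1.
-/

noncomputable section

open scoped Classical NumberField NumberTheorySymbols ComplexConjugate
open NumberField IsDedekindDomain WeierstrassCurve Rat.HeightOneSpectrum
  Literature.NumberTheory.GaloisRepresentations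
  Literature.NumberTheory.EllipticCurves
  Literature.NumberTheory.QuadraticFields
open Literature.NumberTheory.LFunctions (idealPow)

namespace Summit.BirchSwinnertonDyer.BirchSwinnertonDyer.Theorems.BiquadraticEisensteinDescentDeuringOfCore

variable {K : Type} [Field K] [NumberField K]

/-! ## §1 Ideal Größencharakter datum with one bad prime ⇒ CORE -/

/-- In a prime `𝔭 ∋ ℓ`, an integer `n` prime to `ℓ` is a unit: `n ∉ 𝔭`. [cite: NeukirchANT1999, Ch. I §3 (3.1)] -/
theorem intCast_notMem_of_natCast_mem {ℓ : ℕ} {n : ℤ} (hnℓ : IsCoprime n ℓ) {v : HeightOneSpectrum (𝓞 K)}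
    (hv : ((ℓ : ℕ) : 𝓞 K) ∈ v.asIdeal) : ((n : ℤ) : 𝓞 K) ∉ v.asIdeal := by
  intro hmem
  obtain ⟨u, t, hut⟩ := hnℓ
  have h1 : (1 : 𝓞 K) = (u : 𝓞 K) * (n : 𝓞 K) + (t : 𝓞 K) * ((ℓ : ℕ) : 𝓞 K) := by exact_mod_cast hut.symm
  exact v.isPrime.ne_top (by
    rw [Ideal.eq_top_iff_one, h1]
    exact v.asIdeal.add_mem (v.asIdeal.mul_mem_left _ hmem) (v.asIdeal.mul_mem_left _ hv))

/-- Two distinct rational primes do not lie in a common prime of `𝓞 K`. [cite: NeukirchANT1999, Ch. I §3 (3.1)] -/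
theorem natCast_notMem_of_natCast_mem_of_ne {ℓ p : ℕ} (hℓ : ℓ.Prime) (hp : p.Prime) (hpℓ : p ≠ ℓ)
    {v : HeightOneSpectrum (𝓞 K)} (hv : ((p : ℕ) : 𝓞 K) ∈ v.asIdeal) : ((ℓ : ℕ) : 𝓞 K) ∉ v.asIdeal := by
  have hcop : IsCoprime (ℓ : ℤ) (p : ℕ) := Nat.isCoprime_iff_coprime.mpr ((Nat.coprime_primes hℓ hp).mpr (Ne.symm hpℓ))
  have h := intCast_notMem_of_natCast_mem (K := K) hcop hv
  rwa [Int.cast_natCast] at h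

/-- ★ **Ideal Größencharakter datum with one bad prime ⇒ the CORE of Deuring's theorem.** Let `K` be imaginary quadratic with
`p ∣ d_K ↔ p = ℓ`, `c ≠ 1`, `ψ₀` a Größencharakter `mod 𝔣 ≠ 0` of type `(1, 0)` with `𝔣 ∣ 𝔭 ↔ ℓ ∈ 𝔭`, `n ∈ ℤ` prime to `ℓ` with
`ψ̃₀((n)) ≠ n`; let `W/ℚ` be elliptic with `a_ℓ(W) = 0`, `p ∣ N_W ↔ p = ℓ`, and at every `p ≠ ℓ`, `𝔭 ∋ p`: split
`ψ₀(𝔭) + ψ₀(c𝔭) = a_p(W)`, `ψ₀(𝔭) ψ₀(c𝔭) = p`; inert `a_p(W) = 0`, `ψ₀(𝔭) = −p`. Then `ψ = heckeOfGross ψ₀` has type `(1,0)` and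
`L(s, ψ) = L(W, s)` on `re s > 3/2` (local factors at `p ≠ ℓ` by Deuring's values; at `ℓ` both are `1`, `ψ` being RAMIFIED at the prime
over `ℓ` by the witness `n`, `not_isUnramifiedAt_heckeOfGross_of_ne`). [cite: SilvermanATAEC1994, Ch. II Thm. 9.2 (a), Thm. 10.5 (b), Ex. 2.30–2.32]
[cite: NeukirchANT1999, Ch. VII §6 Cor. (6.14)] -/
theorem core_of_datum (W : WeierstrassCurve ℚ) [W.IsElliptic] [IsTotallyComplex K] (h2 : Module.finrank ℚ K = 2)
    {ℓ : ℕ} (hℓ : ℓ.Prime) (hdisc : ∀ p : ℕ, p.Prime → ((p : ℤ) ∣ NumberField.discr K ↔ p = ℓ))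
    {c : K ≃ₐ[ℚ] K} (hc : c ≠ 1) {𝔣 : Ideal (𝓞 K)} {ψ₀ : HeightOneSpectrum (𝓞 K) → ℂ} (h𝔣 : 𝔣 ≠ ⊥)
    (hψ₀ : IsGrossencharakter 𝔣 (fun _ ↦ 1) (fun _ ↦ 0) ψ₀)
    (h𝔣v : ∀ v : HeightOneSpectrum (𝓞 K), 𝔣 ≤ v.asIdeal ↔ ((ℓ : ℕ) : 𝓞 K) ∈ v.asIdeal)
    {n : ℤ} (hnℓ : IsCoprime n ℓ) (hwit : idealPow K ψ₀ (Ideal.span {((n : ℤ) : 𝓞 K)}) ≠ (n : ℂ))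
    (hfrob : ∀ p : ℕ, p.Prime → p ≠ ℓ → ∀ v : HeightOneSpectrum (𝓞 K), (p : 𝓞 K) ∈ v.asIdeal →
      (c • v ≠ v → ψ₀ v + ψ₀ (c • v) = ((W.LFunction p : ℤ) : ℂ) ∧ ψ₀ v * ψ₀ (c • v) = p) ∧
      (c • v = v → W.LFunction p = 0 ∧ ψ₀ v = -(p : ℂ)))
    (hℓ0 : W.LFunction ℓ = 0) (hN : ∀ p : ℕ, p.Prime → (p ∣ W.conductorNorm ℤ ↔ p = ℓ)) :
    ∃ ψ : HeckeCharacter K, ψ.HasInfinityType (fun _ ↦ 1) (fun _ ↦ 0) ∧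
      ∀ s : ℂ, 3 / 2 < s.re → heckeLFunction ψ s = W.LSeries s := by
  refine ⟨heckeOfGross h𝔣 hψ₀, heckeOfGross_hasInfinityType h𝔣 hψ₀, fun s hs ↦
    heckeLFunction_eq_LSeries_of_frobenius h2 hc (heckeOfGross_hasInfinityType h𝔣 hψ₀) W ?_ ?_ hs⟩
  · -- the bad prime `ℓ`: `a_ℓ = 0` and `ψ` is ramified at the prime over `ℓ`
    intro p hp hpN
    obtain rfl : p = ℓ := (hN p hp).mp hpN
    refine ⟨hℓ0, fun w hw ↦ ?_⟩
    have h𝔣w : 𝔣 ≤ w.asIdeal := (h𝔣v w).mpr hw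
    have haw : ((n : ℤ) : 𝓞 K) ∉ w.asIdeal := intCast_notMem_of_natCast_mem hnℓ hw
    have hcop : IsCoprime (Ideal.span {((n : ℤ) : 𝓞 K)}) 𝔣 := by
      rw [Ideal.isCoprime_iff_sup_eq]
      by_contra hne
      obtain ⟨M, hM, hle⟩ := Ideal.exists_le_maximal _ hne
      have hMbot : M ≠ ⊥ := fun h0 ↦ h𝔣 (le_bot_iff.mp (h0 ▸ (le_sup_right.trans hle)))
      let v : HeightOneSpectrum (𝓞 K) := ⟨M, hM.isPrime, hMbot⟩
      have hℓv : ((p : ℕ) : 𝓞 K) ∈ v.asIdeal := (h𝔣v v).mp (le_sup_right.trans hle)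
      have hnv : ((n : ℤ) : 𝓞 K) ∈ v.asIdeal := hle (Ideal.mem_sup_left (Ideal.mem_span_singleton_self _))
      exact intCast_notMem_of_natCast_mem hnℓ hℓv hnv
    have hcong : ∀ v : HeightOneSpectrum (𝓞 K), v ≠ w → modulusExp 𝔣 v ≠ 0 →
        ((n : ℤ) : 𝓞 K) - 1 ∈ v.asIdeal ^ modulusExp 𝔣 v := by
      intro v hvw hv
      have hle : 𝔣 ≤ v.asIdeal := (modulusExp_ne_zero_iff _ h𝔣 v).mp hv
      have hqv : ((p : ℕ) : 𝓞 K) ∈ v.asIdeal := (h𝔣v v).mp hle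
      exact absurd (GrossCurve.eq_of_natCast_mem_of_dvd_discr h2 hp ((hdisc p hp).mpr rfl) hqv hw) hvw
    have hcard : Fintype.card (InfinitePlace K) = 1 := Literature.NumberTheory.NumberFields.ImaginaryQuadratic.card_infinitePlace h2
    have hne : idealPow K ψ₀ (Ideal.span {((n : ℤ) : 𝓞 K)}) ≠
        ∏ w' : InfinitePlace K, w'.embedding (((n : ℤ) : 𝓞 K) : K) ^ (fun _ : InfinitePlace K ↦ (1 : ℤ)) w' *
          conj (w'.embedding (((n : ℤ) : 𝓞 K) : K)) ^ (fun _ : InfinitePlace K ↦ (0 : ℤ)) w' := by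
      have hc : ∀ w' : InfinitePlace K, w'.embedding (((n : ℤ) : 𝓞 K) : K) = (n : ℂ) := fun w' ↦ by
        rw [show (((n : ℤ) : 𝓞 K) : K) = (n : K) from rfl, map_intCast]
      simp only [hc, zpow_one, zpow_zero, mul_one, Finset.prod_const, Finset.card_univ, hcard, pow_one]
      exact hwit
    exact not_isUnramifiedAt_heckeOfGross_of_ne h𝔣 hψ₀ h𝔣w haw hcop hcong hne
  · -- the good primes `p ≠ ℓ`
    intro p hp hpN w hw
    have hpℓ : p ≠ ℓ := fun h' ↦ hpN ((hN p hp).mpr h')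
    have hnot : ∀ v : HeightOneSpectrum (𝓞 K), ((p : ℕ) : 𝓞 K) ∈ v.asIdeal → ¬ 𝔣 ≤ v.asIdeal := fun v hv h ↦
      natCast_notMem_of_natCast_mem_of_ne hℓ hp hpℓ hv ((h𝔣v v).mp h)
    have hv' : ¬ 𝔣 ≤ w.asIdeal := hnot w hw
    have hcw : (p : 𝓞 K) ∈ (c • w).asIdeal := (OmegaPrime.natCast_mem_smul_asIdeal_iff c w p).mpr hw
    have hcv' : ¬ 𝔣 ≤ (c • w).asIdeal := hnot _ hcw
    have hnd : ¬ (p : ℤ) ∣ NumberField.discr K := fun hd ↦ hpℓ ((hdisc p hp).mp hd)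
    obtain ⟨hsplit, hinert⟩ := hfrob p hp hpℓ w hw
    rw [heckeOfGross_valueAtUniformizer h𝔣 hψ₀ hv', heckeOfGross_valueAtUniformizer h𝔣 hψ₀ hcv']
    exact ⟨heckeOfGross_isUnramifiedAt h𝔣 hψ₀ hv', GrossCurve.ramificationIdx_eq_one_of_natCast_mem h2 hp hnd hw, hsplit, hinert⟩

/-! ## §2 CORE for `B₋₁ = [0, −4, 0, 2, 0]` over every CM field of `j = 8000` -/

/-- `d_K = −8` data of a CM field of `j = 8000`: `[K:ℚ] = 2`, a `θ` with `θ² = −2`, `d_K = −8`.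
[cite: SilvermanATAEC1994, App. A §3 (row D = −8)] -/
theorem fieldData_of_isCMFieldOfJ_8000 (hK : IsCMFieldOfJ K 8000) :
    ∃ θ : K, SqrtNegTwo.FieldData θ ∧ NumberField.discr K = -8 := by
  obtain ⟨θ, hθ⟩ := hK.2
  have h8 : cmFieldDiscr 8000 = -8 := by norm_num [cmFieldDiscr]
  rw [h8] at hθ
  have hdK : NumberField.discr K = -8 := Quadratic.discr_eq_of_sq_eq_intCast hK.1 hθ (by decide)
  refine ⟨θ / 2, ⟨hK.1, ?_⟩, hdK⟩
  rw [div_pow, hθ]; push_cast; norm_num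

/-- `B₋₁ = cm8^{(−1)}` is the member `n = −1` of the tree's family `[0, 4n, 0, 2n², 0]`. [cite: SilvermanAEC2009, X.5 Cor. 5.4.1] -/
theorem cm8_quadraticTwist_neg_one_eq :
    cm8.quadraticTwist (-1 : ℚ) = (⟨0, 4 * ((-1 : ℤ) : ℚ), 0, 2 * ((-1 : ℤ) : ℚ) ^ 2, 0⟩ : WeierstrassCurve ℚ) := by
  rw [show ((-1 : ℤ) : ℚ) = -1 by norm_num]
  exact SqrtTwoTwist.quadraticTwist_B_one (-1)

/-- `cm8 = B₁` is the member `n = 1` of the family `[0, 4n, 0, 2n², 0]`. [cite: SilvermanAEC2009, X.5 Cor. 5.4.1] -/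
theorem cm8_eq : cm8 = (⟨0, 4 * ((1 : ℤ) : ℚ), 0, 2 * ((1 : ℤ) : ℚ) ^ 2, 0⟩ : WeierstrassCurve ℚ) := by
  show (⟨0, 4, 0, 2, 0⟩ : WeierstrassCurve ℚ) = _
  ext <;> norm_num

/-- An odd prime does not divide `2n`, `n = ±1`. [cite: Rajwade1968, Thm. 1] -/
theorem not_dvd_two_mul_unit {p : ℕ} (hp : p.Prime) (hp2 : p ≠ 2) {n : ℤ} (hn : n = 1 ∨ n = -1) : ¬ (p : ℤ) ∣ 2 * n := by
  intro hd
  have h2 : (p : ℤ) ∣ 2 := by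
    rcases hn with rfl | rfl
    · rwa [mul_one] at hd
    · rwa [mul_neg, mul_one, dvd_neg] at hd
  exact hp2 ((Nat.prime_dvd_prime_iff_eq hp Nat.prime_two).mp (by exact_mod_cast h2))

/-- The bad primes of `B_n`, `n = ±1`: `p ∣ N ↔ p = 2`, and `a_2 = 0`. [cite: SilvermanAEC2009, VII.5 Prop. 5.1] [cite: Rajwade1968, Thm. 1] -/
theorem conductor_B_unit {n : ℤ} (hn : n = 1 ∨ n = -1) :
    (∀ p : ℕ, p.Prime → (p ∣ (⟨0, 4 * (n : ℚ), 0, 2 * (n : ℚ) ^ 2, 0⟩ : WeierstrassCurve ℚ).conductorNorm ℤ ↔ p = 2)) ∧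
      (⟨0, 4 * (n : ℚ), 0, 2 * (n : ℚ) ^ 2, 0⟩ : WeierstrassCurve ℚ).LFunction 2 = 0 := by
  have hn0 : n ≠ 0 := by rcases hn with rfl | rfl <;> norm_num
  have hsq : Squarefree n := by rcases hn with rfl | rfl <;> exact Int.squarefree_natAbs.mp (by simp)
  have hodd : Odd n := by rcases hn with rfl | rfl <;> decide
  haveI := SqrtTwoTwist.isElliptic_B_rat hn0
  refine ⟨fun p hp ↦ ?_, by simpa using SqrtTwoTwist.lFunction_B_apply_prime_pow_of_dvd hsq hodd Nat.prime_two (dvd_mul_right 2 n) 0⟩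
  haveI : Fact p.Prime := ⟨hp⟩
  obtain ⟨v, hvp⟩ : ∃ v : HeightOneSpectrum (𝓞 ℚ), (primesEquiv v : ℕ) = p := ⟨primesEquiv.symm ⟨p, hp⟩, by rw [Equiv.apply_symm_apply]⟩
  subst hvp
  rw [dvd_conductorNorm_iff_not_hasGoodReductionAtPrime]
  constructor
  · intro hbad
    by_contra hp2
    exact hbad ((hasGoodReductionAtPrime_iff_hasGoodReductionAt_ringOfIntegers v _).mpr
      (SqrtTwoTwist.hasGoodReductionAt_B v (not_dvd_two_mul_unit hp hp2 hn)))
  · intro h2 hgood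
    exact ((hasGoodReductionAtPrime_iff_hasGoodReductionAt_ringOfIntegers v _).mp hgood).not_hasAdditiveReductionAt
      (SqrtTwoTwist.hasAdditiveReductionAt_B_two v hodd h2)

/-- ★ **CORE for `B₋₁ = [0, −4, 0, 2, 0]` (`256`-family, `a_p = S(p)`) over every CM field of `j = 8000`.** `ψ = heckeOfGross` of Rajwade's
character `(π) ↦ primary π mod (4√−2)` (`SqrtNegTwo.exists_isGrossencharakter_datum`, seat w1 g14), witness `n = 5` (`ψ̃₀((5)) = −5`),
`a_m(B₋₁) = S(m)` by `SqrtTwoTwist.lFunction_eq_jacobiSym_mul_primarySum` and Brewer's theorem. [cite: Rajwade1968, Thm. 1]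
[cite: SilvermanATAEC1994, Ch. II Thm. 10.5 (b)] -/
theorem core_cm8_quadraticTwist_neg_one (hK : IsCMFieldOfJ K 8000) :
    ∃ ψ : HeckeCharacter K, ψ.HasInfinityType (fun _ ↦ 1) (fun _ ↦ 0) ∧
      ∀ s : ℂ, 3 / 2 < s.re → heckeLFunction ψ s = (cm8.quadraticTwist (-1 : ℚ)).LSeries s := by
  obtain ⟨θ, hF, hdK⟩ := fieldData_of_isCMFieldOfJ_8000 hK
  have h2 := hK.1
  haveI := hF.isTotallyComplex
  obtain ⟨c, hc⟩ := GrossCurve.exists_algEquiv_ne_one (K := K) h2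
  obtain ⟨w₀⟩ : Nonempty (InfinitePlace K) := inferInstance
  rw [cm8_quadraticTwist_neg_one_eq]
  set B : WeierstrassCurve ℚ := ⟨0, 4 * ((-1 : ℤ) : ℚ), 0, 2 * ((-1 : ℤ) : ℚ) ^ 2, 0⟩ with hB
  haveI : B.IsElliptic := SqrtTwoTwist.isElliptic_B_rat (by norm_num)
  have hsq : Squarefree (-1 : ℤ) := Int.squarefree_natAbs.mp (by simp)
  have hf : ∀ p : ℕ, p.Prime → p ≠ 2 → (((fun p : ℕ ↦ B.LFunction p) p : ℤ) : ℤ√(-2)) = SqrtNegTwoPrimary.primarySum p := by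
    intro p hp _
    have h := SqrtTwoTwist.lFunction_eq_jacobiSym_mul_primarySum SqrtTwoTwist.brewer1961_characterSum_holds hsq (by decide)
      (m := p) hp.ne_zero
    rw [neg_neg, jacobiSym.one_left, Int.cast_one, one_mul] at h
    exact h
  obtain ⟨𝔣, ψ₀, h𝔣, h𝔣v, hψ₀, -, hwit, hfrob⟩ := SqrtNegTwo.exists_isGrossencharakter_datum hF hc w₀ (fun p : ℕ ↦ B.LFunction p) hf
  obtain ⟨hN, h20⟩ := conductor_B_unit (n := -1) (Or.inr rfl)
  have hdisc : ∀ p : ℕ, p.Prime → ((p : ℤ) ∣ NumberField.discr K ↔ p = 2) := by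
    intro p hp
    rw [hdK, dvd_neg, show (8 : ℤ) = ((2 ^ 3 : ℕ) : ℤ) by norm_num, Int.natCast_dvd_natCast]
    exact ⟨fun h ↦ (Nat.prime_dvd_prime_iff_eq hp Nat.prime_two).mp (hp.dvd_of_dvd_pow h), fun h ↦ by subst h; norm_num⟩
  refine core_of_datum B h2 Nat.prime_two hdisc hc h𝔣 hψ₀ (fun v ↦ by rw [h𝔣v v, Nat.cast_ofNat]) (n := 5)
    (Int.isCoprime_iff_gcd_eq_one.mpr rfl) ?_ (fun p hp hp2 v hv ↦ (hfrob p hp hp2 v hv).2) h20 hN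
  have h5 := hwit 5 (Or.inl rfl)
  rw [show ((5 : ℕ) : 𝓞 K) = ((5 : ℤ) : 𝓞 K) by push_cast; rfl] at h5
  rw [h5]; push_cast; norm_num

/-! ## §3 The row `j = 8000` modulo CORE(`cm8`) -/

/-- `cm8` and `cm8^{(−1)}` have good reduction at every odd prime. [cite: SilvermanAEC2009, VII.5 Prop. 5.1 (a)] -/
theorem hasGoodReductionAtPrime_cm8 (p : ℕ) [Fact p.Prime] (hp2 : p ≠ 2) :
    cm8.HasGoodReductionAtPrime p ∧ (cm8.quadraticTwist (-1 : ℚ)).HasGoodReductionAtPrime p := by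
  obtain ⟨v, rfl⟩ : ∃ v : HeightOneSpectrum (𝓞 ℚ), (primesEquiv v : ℕ) = p :=
    ⟨primesEquiv.symm ⟨p, Fact.out⟩, by rw [Equiv.apply_symm_apply]⟩
  constructor
  · rw [cm8_eq]
    exact (hasGoodReductionAtPrime_iff_hasGoodReductionAt_ringOfIntegers v _).mpr
      (SqrtTwoTwist.hasGoodReductionAt_B v (not_dvd_two_mul_unit Fact.out hp2 (Or.inl rfl)))
  · rw [cm8_quadraticTwist_neg_one_eq]
    exact (hasGoodReductionAtPrime_iff_hasGoodReductionAt_ringOfIntegers v _).mpr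
      (SqrtTwoTwist.hasGoodReductionAt_B v (not_dvd_two_mul_unit Fact.out hp2 (Or.inr rfl)))

/-- **The row `j = 8000` of the CORE, modulo CORE(`cm8`)**: if `B₁ = cm8 = [0,4,0,2,0]` carries a Hecke character of `K` of type `(1,0)`
with `L(s, ψ) = L(B₁, s)`, then so does EVERY elliptic `W/ℚ` with `W.j = 8000` (second base `B₋₁` by §2, then
`core_of_j_eq_of_core_pair_two`). [cite: SilvermanATAEC1994, Ch. II Thm. 10.5 (b)] [cite: SilvermanAEC2009, X.5 Cor. 5.4.1] -/
theorem core_of_j_eq_8000_of_core_cm8 (hK : IsCMFieldOfJ K 8000)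
    (hcore8 : ∃ ψ : HeckeCharacter K, ψ.HasInfinityType (fun _ ↦ 1) (fun _ ↦ 0) ∧
      ∀ s : ℂ, 3 / 2 < s.re → heckeLFunction ψ s = cm8.LSeries s)
    (W : WeierstrassCurve ℚ) [W.IsElliptic] (hjW : W.j = 8000) :
    ∃ ψ : HeckeCharacter K, ψ.HasInfinityType (fun _ ↦ 1) (fun _ ↦ 0) ∧
      ∀ s : ℂ, 3 / 2 < s.re → heckeLFunction ψ s = W.LSeries s := by
  have hK' : IsCMFieldOfJ K cm8.j := by rw [j_cm8]; exact hK
  exact core_of_j_eq_of_core_pair_two cm8 (by rw [j_cm8]; exact SqrtTwoTwist.eight_thousand_mem_maximalCMJInvariants)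
    (by rw [j_cm8]; norm_num) (by rw [j_cm8]; norm_num) hK' (by rw [j_cm8]; norm_num [cmFieldDiscr])
    (fun p _ hp2 ↦ (hasGoodReductionAtPrime_cm8 p hp2).1) (fun p _ hp2 ↦ (hasGoodReductionAtPrime_cm8 p hp2).2)
    hcore8 (core_cm8_quadraticTwist_neg_one hK) W (by rw [hjW, j_cm8])

/-- **Deuring's theorem, row `j = 8000`, modulo CORE(`cm8`)**: all five clauses of `Deuring_exists_heckeCharacter_of_maximalCM` for every
globally minimal `W` with `W.j = 8000`, every CM field `K` of `8000` and every `c ≠ 1`, from a Hecke character of `cm8 = [0,4,0,2,0]`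
(`deuring_of_core_at`). [cite: SilvermanATAEC1994, Ch. II Thm. 9.2, Thm. 10.5] -/
theorem deuring_of_j_eq_8000_of_core_cm8 (W : WeierstrassCurve ℚ) [W.IsElliptic] [W.IsGloballyMinimal] (hjW : W.j = 8000)
    (K : Type) [Field K] [NumberField K] (hK : IsCMFieldOfJ K W.j)
    (hcore8 : ∃ ψ : HeckeCharacter K, ψ.HasInfinityType (fun _ ↦ 1) (fun _ ↦ 0) ∧
      ∀ s : ℂ, 3 / 2 < s.re → heckeLFunction ψ s = cm8.LSeries s)
    (c : K ≃ₐ[ℚ] K) (hc : c ≠ 1) :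
    ∃ ψ : HeckeCharacter K,
      ψ.HasInfinityType (fun _ ↦ 1) (fun _ ↦ 0) ∧
      IsHeckeConjEquivariant c ψ ∧
      (∀ w : HeightOneSpectrum (𝓞 K), ψ.IsUnramifiedAt w ↔ (W.baseChange K).HasGoodReductionAt w) ∧
      (∀ (p : ℕ) [Fact p.Prime], W.HasGoodReductionAtPrime p →
        ∀ w : HeightOneSpectrum (𝓞 K), (p : 𝓞 K) ∈ w.asIdeal →
          ψ.IsUnramifiedAt w ∧
          (c • w ≠ w →
            ψ.valueAtUniformizer w + ψ.valueAtUniformizer (c • w) = (W.frobeniusTrace p : ℂ) ∧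
            ψ.valueAtUniformizer w * ψ.valueAtUniformizer (c • w) = (p : ℂ)) ∧
          (c • w = w → W.frobeniusTrace p = 0 ∧ ψ.valueAtUniformizer w = -(p : ℂ))) ∧
      ∀ s : ℂ, 3 / 2 < s.re → heckeLFunction ψ s = W.LSeries s := by
  have hK8 : IsCMFieldOfJ K 8000 := by rw [← hjW]; exact hK
  exact deuring_of_core_at W (by rw [hjW]; exact SqrtTwoTwist.eight_thousand_mem_maximalCMJInvariants) K hK c hc
    (core_of_j_eq_8000_of_core_cm8 hK8 hcore8 W hjW)

end Summit.BirchSwinnertonDyer.BirchSwinnertonDyer.Theorems.BiquadraticEisensteinDescentDeuringOfCore
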